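import Summits.BirchSwinnertonDyer.BirchSwinnertonDyer.Theorems.ClassRecordThreeCornerAtThreeShimuraFamilyKeyRelation
import Summits.BirchSwinnertonDyer.BirchSwinnertonDyer.Theorems.ClassRecordThreeCornerAtThreeShimuraFamilyCoherentData
import Summits.BirchSwinnertonDyer.BirchSwinnertonDyer.Theorems.ClassRecordThreeCornerAtThreeShimuraFamilyLabels
import Summits.BirchSwinnertonDyer.BirchSwinnertonDyer.Theorems.ClassRecordThreeCornerAtThreeShimuraFamilySupplyFromLabels
import Summits.BirchSwinnertonDyer.BirchSwinnertonDyer.Theorems.ClassRecordThreeCornerAtThreeShimuraFamilyTransverse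
import Summits.BirchSwinnertonDyer.BirchSwinnertonDyer.Theorems.ClassRecordThreeCornerAtThreeShimuraFamilyChoiceFree
import Summits.BirchSwinnertonDyer.BirchSwinnertonDyer.Theorems.ClassRecordThreeEulerHalvesAtThreeWalkSupplyDisjoint
import Literature.NumberTheory.EllipticCurves.CasselsTateSelmerKolyvaginValue
import Literature.NumberTheory.EllipticCurves.KummerSelmerStructure
import HarnessLib

/-!
# McCallum 1991 Prop. 4.4 in ORDER form for ARBITRARY pairs of generalised Kolyvagin data on a Shimura frame —
# the producer `h47` of tam3-p1's `Koly.familyLevelSupply_of_memberships`: `ord loc_λ c_k(d′) = ord loc_λ c_k(d)` for ANY data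
# `d` (level `n`), `d′` (level `nℓ`) with `d.y = ys n`, `d′.y = ys (nℓ)` (cell `bsd-stepL`, seat `bsd-stepL-corner3-p2` g8 =
# WIDTH-LEVER lane B; `--supports stmt-BirchSwinnertonDyer-21420 --as helper`)

WHY. tam3-p1's GROSS-keyed (P2) assembly takes `h47 : ∀ k n n' d d' ℓ, d.y = ys n → d'.y = ys n' → … → n' = n * ℓ → ∀ v ∋ ℓ,
addOrderOf (loc_v c_k(d')) = addOrderOf (loc_v c_k(d))` for UNRELATED data. Lane B's key relation (p601020, McCallum 4.4 in membership
form) is proved for COHERENT data. THIS FILE assembles the order form for arbitrary pairs: (i) a coherent family `D` on the divisors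
of `nℓ` with `D.y = ys` (p600796) carries the labels (B4), (B5) in datum form (p601736) and admissible `E(K[m])` (no `p`-torsion), so
p601020 gives `p^a c(D nℓ) ∈ Sel_λ ⟺ p^a c(D n) ∈ ker loc_λ`; (ii) `c(D nℓ)` is TRANSVERSE at `ℓ` (p603631, Howard 2.7.3) and the
Kummer and transverse conditions at `λ` are DISJOINT (tam3-p1 `disjoint_kummer_iInf_transverseSubgroup`), so `p^a c(D nℓ) ∈ Sel_λ ⟺
loc_λ (p^a c(D nℓ)) = 0`; (iii) orders of `p`-power-torsion elements are determined by which `p^a` kill them; (iv) CHOICE-FREENESS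
(p604141): `addOrderOf ∘ loc_λ ∘ c_k` depends on `(level, y)` only, transporting (i)–(iii) from `(D nℓ, D n)` to `(d', d)`.

RESULTS (namespace `Summit.BirchSwinnertonDyer.BirchSwinnertonDyer.Theorems.ShimuraWalk`):
* `addOrderOf_eq_of_forall_pow_smul_eq_zero_iff` — (iii), pure algebra.
* `localization_zsmul_eq_zero_iff_mem_torsionLocalKer` — `loc_v (j • x) = 0 ⟺ j • x ∈ torsionLocalKer K_v` (dictionary).
* `mem_selmerLocalKer_iff_mem_torsionLocalKer_of_mem_transverseKer` — (ii) for any transverse class at a Kolyvagin `λ ∣ ℓ`.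
* `addOrderOf_localization_kolyvaginClass_familyData_eq_of_labels` — THE PRODUCER `h47` (tam3-p1's binder shape, `n' = n * ℓ`).
* `addOrderOf_localization_kolyvaginClass_familyData_eq_of_labels_of_admissible` — the same with admissibility in the ∀-datum
  shape `hA` of the closing composition (instead of no-`p`-torsion `htor`) and `1 ≤ k`.

HONEST FRAMING. Helper lemmas toward crux 21420 `CornerAtThreeW` (line `Lines/inert.lean` r7, stub `stub_upper3_residualMulti`) and
19109; nothing about BSD, `J₃`, or any divisibility of a Heegner point is asserted; no stub is discharged; no item closes; 0 classes
move (T7). `K : Type`. Standing hypotheses as in bsd-jet ∕ tam3-p1: `d_K < -4`, `p` odd, no `p`-power torsion in `E(K[m])` for `p ∤ m`.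
References: [cite: McCallumLMS1991, §4 Prop. 4.4, Cor. 4.5, Lemma 4.6] [cite: GrossLMS1991, Prop. 3.7, §4 (4.4)] [cite: Jetchev2008, §4.2,
Prop. 4.6, Prop. 4.10] [cite: Howard2004HeegnerKolyvagin, Lemma 2.7.3] [cite: MazurRubin2004, Lemma 1.2.4]. Axioms: `propext`,
`Classical.choice`, `Quot.sound`.
-/

set_option autoImplicit false
set_option linter.dupNamespace false

noncomputable section

open scoped Classical

namespace Summit.BirchSwinnertonDyer.BirchSwinnertonDyer.Theorems.ShimuraWalk

open WeierstrassCurve Field NumberField IsDedekindDomain Finset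
  Literature.NumberTheory.EllipticCurves Literature.NumberTheory.GaloisRepresentations
  Literature.NumberTheory.GaloisRepresentations.DiscreteGaloisModule
  Literature.NumberTheory.EllipticCurves.KolyvaginCocycle
  Literature.NumberTheory.EllipticCurves.RingClassField
  Literature.NumberTheory.EllipticCurves.ModularForms
  Literature.NumberTheory.EllipticCurves.Jetchev2008 Literature.NumberTheory.Automorphic
  Summit.BirchSwinnertonDyer.Rank1Residual.X11b Summit.BirchSwinnertonDyer.Rank1Residual.X11b.Three
  Summit.BirchSwinnertonDyer.Rank1Residual.JET Summit.BirchSwinnertonDyer.Rank1Residual.JET.SelmerVocabulary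
  Summit.BirchSwinnertonDyer.Rank1Residual.JET.Walk
  Summit.BirchSwinnertonDyer.BirchSwinnertonDyer.Theorems

variable {K : Type} [Field K] [NumberField K] {W : WeierstrassCurve ℚ} {ι : K →+* ℂ}

/-! ## §1 Algebra and the dictionary `loc_v = 0 ⟺ torsionLocalKer` -/

omit [NumberField K] in
/-- Two `p^k`-torsion elements killed by the same powers of `p` have the same order. [folklore] -/
theorem addOrderOf_eq_of_forall_pow_smul_eq_zero_iff {X Y : Type*} [AddCommGroup X] [AddCommGroup Y] {p k : ℕ}
    (hp : p.Prime) {x : X} {y : Y} (hx : p ^ k • x = 0) (hy : p ^ k • y = 0)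
    (h : ∀ a : ℕ, p ^ a • x = 0 ↔ p ^ a • y = 0) : addOrderOf x = addOrderOf y := by
  obtain ⟨i, -, hi⟩ := (Nat.dvd_prime_pow hp).mp (addOrderOf_dvd_of_nsmul_eq_zero hx)
  obtain ⟨j, -, hj⟩ := (Nat.dvd_prime_pow hp).mp (addOrderOf_dvd_of_nsmul_eq_zero hy)
  refine Nat.dvd_antisymm ?_ ?_
  · rw [hj]
    exact addOrderOf_dvd_of_nsmul_eq_zero ((h j).mpr (by rw [← hj]; exact addOrderOf_nsmul_eq_zero y))
  · rw [hi]
    exact addOrderOf_dvd_of_nsmul_eq_zero ((h i).mp (by rw [← hi]; exact addOrderOf_nsmul_eq_zero x))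

/-- **`loc_v (p^a • x) = 0 ⟺ p^a • x ∈ torsionLocalKer K_v`** (x11b3's kernel currency = the walk's localisation currency at a
finite place; tam3-p1's dictionary `mem_torsionLocalKer_iff_res_eq_zero`). [cite: McCallumLMS1991, §3 (3)] -/
theorem localization_pow_smul_eq_zero_iff_mem_torsionLocalKer [W.IsElliptic] {p k : ℕ} (hp : p.Prime)
    (v : HeightOneSpectrum (𝓞 K)) (x : galH1Torsion (W.baseChange K) ((p ^ k : ℕ) : ℤ)) (a : ℕ) :
    p ^ a • galoisCohomology.localization ((W.baseChange K).torsionGaloisModule ((p ^ k : ℕ) : ℤ)) (Sum.inr v) 1 x = 0 ↔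
      ((p : ℤ) ^ a) • x ∈ (W.baseChange K).torsionLocalKer (v.adicCompletion K) ((p ^ k : ℕ) : ℤ) := by
  -- adapted from tam3-p1's `hloc` in `ClassRecordThreeEulerHalvesAtThreeWalkCebotarev`
  haveI : (W.baseChange K).IsElliptic := by unfold WeierstrassCurve.baseChange; infer_instance
  haveI : CharZero (v.adicCompletion K) := charZero_of_injective_algebraMap (algebraMap K _).injective
  have hz : ((p : ℤ) ^ a) • x = p ^ a • x := by
    rw [← natCast_zsmul]; push_cast; rfl
  rw [← map_nsmul, hz, mem_torsionLocalKer_iff_res_eq_zero (W := W.baseChange K)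
    (E := v.adicCompletion K) (pow_ne_zero k hp.ne_zero)]
  exact Iff.rfl

/-! ## §2 Transverse classes: `Sel_λ`-membership is `ker loc_λ`-membership -/

/-- **For a class TRANSVERSE at `ℓ`, the Selmer (Kummer) local condition at the place `λ ∋ ℓ` of a Kolyvagin prime is the
vanishing of the localisation**: `x ∈ transverseKer ℓ` gives `loc_λ x ∈ ⨅_{w' ∣ λ} H¹_tr(K[ℓ]_{w'})`, which meets `H¹_Kum(K_λ)`
trivially (tam3-p1's `disjoint_kummer_iInf_transverseSubgroup`); conversely `ker loc_λ ≤ Sel_λ`. [cite: Jetchev2008, §4.2 (p. 818)]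
[cite: MazurRubin2004, Lemma 1.2.4] [cite: McCallumLMS1991, §3 (3)] -/
theorem mem_selmerLocalKer_iff_mem_torsionLocalKer_of_mem_transverseKer [W.IsElliptic] [W.IsGloballyMinimal]
    (hK : IsImaginaryQuadratic K) (hD : NumberField.discr K < -4) (ι : K →+* ℂ)
    [∀ j : ℕ, NumberField (ringClassField K ι j)] {p : ℕ} [Fact p.Prime] (k : ℕ)
    {ℓ : ℕ} (hℓ : Zhang2014.IsKolyvaginPrime (W.conductorNorm ℤ) W K p ℓ)
    (v : HeightOneSpectrum (𝓞 K)) (hv : (ℓ : 𝓞 K) ∈ v.asIdeal)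
    (x : galH1Torsion (W.baseChange K) ((p ^ k : ℕ) : ℤ)) (hx : x ∈ transverseKer W K ι ((p ^ k : ℕ) : ℤ) ℓ) :
    x ∈ selmerLocalKer (W.baseChange K) (v.adicCompletion K) ((p ^ k : ℕ) : ℤ) ↔
      x ∈ (W.baseChange K).torsionLocalKer (v.adicCompletion K) ((p ^ k : ℕ) : ℤ) := by
  have hp : p.Prime := Fact.out
  have hℓp : ℓ.Prime := hℓ.1
  haveI : (W.baseChange K).IsElliptic := by unfold WeierstrassCurve.baseChange; infer_instance
  haveI : CharZero (v.adicCompletion K) := charZero_of_injective_algebraMap (algebraMap K _).injective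
  refine ⟨fun hsel ↦ ?_, fun h ↦ (W.baseChange K).torsionLocalKer_le_selmerLocalKer (v.adicCompletion K) _ h⟩
  set ρK := (W.baseChange K).torsionGaloisModule ((p ^ k : ℕ) : ℤ) with hρK
  -- `loc_v x` is Kummer …
  have hkum : galoisCohomology.localization ρK (Sum.inr v) 1 x ∈
      (W.baseChange K).kummerSelmerStructure ((p ^ k : ℕ) : ℤ) (Sum.inr v) := by
    have h' : x ∈ ((W.baseChange K).kummerSelmerStructure ((p ^ k : ℕ) : ℤ) (Sum.inr v)).comap
        (galoisCohomology.localization ρK (Sum.inr v) 1) := by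
      rw [(W.baseChange K).comap_localization_kummerSelmerStructure]; exact hsel
    exact AddSubgroup.mem_comap.mp h'
  -- … and transverse at every `w' ∣ v` of `K[ℓ]`
  haveI := (finiteDimensional_and_isGalois_ringClassField hK ι hℓp.ne_zero).2
  have htr : galoisCohomology.localization ρK (Sum.inr v) 1 x ∈
      ⨅ (w' : HeightOneSpectrum (𝓞 (ringClassField K ι ℓ))) (_ : w'.asIdeal.LiesOver v.asIdeal),
        letI := (adicCompletionOfLiesOver K (ringClassField K ι ℓ) v w').toAlgebra
        transverseSubgroup (GaloisRep.toLocal v ρK) (w'.adicCompletion (ringClassField K ι ℓ)) := by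
    refine AddSubgroup.mem_iInf.mpr fun w' ↦ AddSubgroup.mem_iInf.mpr fun hw' ↦ ?_
    haveI : w'.asIdeal.LiesOver v.asIdeal := hw'
    have hℓw' : (ℓ : 𝓞 (ringClassField K ι ℓ)) ∈ w'.asIdeal := by
      have h1 : (ℓ : 𝓞 K) ∈ w'.asIdeal.under (𝓞 K) := hw'.over ▸ hv
      rw [Ideal.under, Ideal.mem_comap, map_natCast] at h1
      exact h1
    exact (localization_mem_transverseSubgroup_iff ρK (ringClassField K ι ℓ) v w' x).mpr
      ((mem_transverseKer_iff W K ι ((p ^ k : ℕ) : ℤ) ℓ x).mp hx w' hℓw')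
  -- disjointness
  have h0 : galoisCohomology.localization ρK (Sum.inr v) 1 x = 0 :=
    (AddSubgroup.disjoint_def.mp (disjoint_kummer_iInf_transverseSubgroup W K hK hD ι k hℓ v hv)) hkum htr
  have h1 : p ^ 0 • galoisCohomology.localization ρK (Sum.inr v) 1 x = 0 := by rw [pow_zero, one_smul]; exact h0
  have := (localization_pow_smul_eq_zero_iff_mem_torsionLocalKer (W := W) hp v x 0).mp h1
  rwa [pow_zero, one_smul] at this

/-! ## §3 The producer `h47` -/

set_option maxHeartbeats 800000 in
/-- **McCallum 4.4 in ORDER form for ARBITRARY pairs of generalised data** — the producer `h47` of tam3-p1's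
`Koly.familyLevelSupply_of_memberships`, on a Shimura frame carrying the labels `LabelsAt W N K ι yK ys ε`: for data `d` at level `n`
and `d'` at level `n' = nℓ` with `d.y = ys n`, `d'.y = ys n'`, `nℓ` square-free with Gross–Kolyvagin prime factors satisfying (3.2)
modulo `p^k`, and a place `λ ∋ ℓ`: `addOrderOf (loc_λ c_k(d')) = addOrderOf (loc_λ c_k(d))`. See the module docstring for the
four-step proof (coherent family + key relation p601020; transverse p603631 + disjointness; `p`-power orders; choice-freeness p604141).
[cite: McCallumLMS1991, §4 Prop. 4.4, Cor. 4.5] [cite: Jetchev2008, Prop. 4.10 (ii)] [cite: GrossLMS1991, Prop. 3.7 (2), §4 (4.4)] -/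
theorem addOrderOf_localization_kolyvaginClass_familyData_eq_of_labels {N : ℕ} [NeZero N] [W.IsElliptic] [W.IsGloballyMinimal]
    (hK : IsImaginaryQuadratic K) (hD : NumberField.discr K < -4) (ι : K →+* ℂ) (hN : W.conductorNorm ℤ = N)
    {p : ℕ} [Fact p.Prime] (hp2 : p ≠ 2) (Dt : ModularParametrizationData W N) [∀ j : ℕ, NumberField (ringClassField K ι j)]
    (htor : ∀ m : ℕ, m ≠ 0 → ¬ p ∣ m →
      ∀ (n' : ℕ) (a : (W.baseChange (ringClassField K ι m)).toAffine.Point), ((p ^ n' : ℕ) : ℤ) • a = 0 → a = 0)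
    (ys : (m : ℕ) → (W.baseChange (ringClassField K ι m)).toAffine.Point)
    {yK : (W.baseChange K).toAffine.Point} {ε : ℤ} (hL : LabelsAt W N K ι yK ys ε)
    (k n n' : ℕ) (d : KolyvaginFamilyData W K ι n) (d' : KolyvaginFamilyData W K ι n') (ℓ : ℕ)
    (hdy : d.y = ys n) (hd'y : d'.y = ys n') (hn : Squarefree n)
    (hKol : ∀ q ∈ n'.primeFactors, IsKolyvaginPrime N W K p q ∧ FrobEqFrobInfty W K (p ^ k) q)
    (hℓ : ℓ.Prime) (hℓn : ¬ ℓ ∣ n) (hn' : n' = n * ℓ)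
    (v : HeightOneSpectrum (𝓞 K)) (hv : (ℓ : 𝓞 K) ∈ v.asIdeal) :
    addOrderOf (galoisCohomology.localization ((W.baseChange K).torsionGaloisModule ((p ^ k : ℕ) : ℤ)) (Sum.inr v) 1
        (d'.kolyvaginClass (Fact.out : p.Prime) k)) =
      addOrderOf (galoisCohomology.localization ((W.baseChange K).torsionGaloisModule ((p ^ k : ℕ) : ℤ)) (Sum.inr v) 1
        (d.kolyvaginClass (Fact.out : p.Prime) k)) := by
  subst hn'
  have hp : p.Prime := Fact.out
  set loc := galoisCohomology.localization ((W.baseChange K).torsionGaloisModule ((p ^ k : ℕ) : ℤ)) (Sum.inr v) 1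
    with hloc
  have hkill : ∀ z : galH1Torsion (W.baseChange K) ((p ^ k : ℕ) : ℤ), p ^ k • z = 0 := fun z ↦ by
    rw [← natCast_zsmul]; exact zsmul_galH1Torsion_eq_zero (W.baseChange K) _ z
  -- the level `k = 0`: `H¹(K, E[1]) = 0`
  rcases Nat.eq_zero_or_pos k with rfl | hkpos
  · have h0 : ∀ z : galH1Torsion (W.baseChange K) ((p ^ 0 : ℕ) : ℤ), z = 0 := fun z ↦ by
      simpa only [pow_zero, one_smul] using hkill z
    rw [h0 (d'.kolyvaginClass hp 0), h0 (d.kolyvaginClass hp 0)]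
  have hk : 1 ≤ k := hkpos
  -- the level `nℓ`
  have hcop : n.Coprime ℓ := (Nat.Coprime.symm ((Nat.Prime.coprime_iff_not_dvd hℓ).mpr hℓn))
  have hnℓ : Squarefree (n * ℓ) := (Nat.squarefree_mul hcop).mpr ⟨hn, hℓ.prime.squarefree⟩
  have hnℓ0 : n * ℓ ≠ 0 := hnℓ.ne_zero
  have hℓmem : ℓ ∈ (n * ℓ).primeFactors := Nat.mem_primeFactors.mpr ⟨hℓ, dvd_mul_left ℓ n, hnℓ0⟩
  have hndvd : n ∣ n * ℓ := dvd_mul_right n ℓ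
  have hdiv : n * ℓ / ℓ = n := Nat.mul_div_cancel n hℓ.pos
  have hKolN : ∀ q ∈ (n * ℓ).primeFactors, IsKolyvaginPrime (W.conductorNorm ℤ) W K p q := fun q hq ↦ hN ▸ (hKol q hq).1
  have hguard : ∀ q ∈ (n * ℓ).primeFactors, ¬ q ∣ N ∧ (Ideal.span {(q : 𝓞 K)}).IsPrime :=
    fun q hq ↦ ⟨(hKol q hq).1.2.1, (hKol q hq).1.2.2.2.2.1⟩
  have hℓZ : Zhang2014.IsKolyvaginPrime (W.conductorNorm ℤ) W K p ℓ :=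
    (Summit.BirchSwinnertonDyer.Rank1Residual.X11b.Three.Koly.zhang_isKolyvaginPrime_of_frobEqFrobInfty (W := W) (K := K)
      hp hk (hKolN ℓ hℓmem) (hKol ℓ hℓmem).2).1
  have hkM : (k : ℕ∞) ≤ frobLevelIndex W K p (n * ℓ) :=
    (natCast_le_frobLevelIndex_iff hKolN k).mpr fun q hq ↦ (hKol q hq).2
  -- (i) a coherent family on the divisors of `nℓ` with `D.y = ys`, its labels and admissibility
  obtain ⟨D, hDy, -, hcoh⟩ := exists_coherent_familyData_y_eq (W := W) hK ι hnℓ (fun q hq ↦ (hguard q hq).2) ys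
  obtain ⟨hB4d, hB5d, -⟩ := familyLabels_of_labelsAt (W := W) hnℓ hguard ys hL D hDy
  have hA : ∀ (m : ℕ) (hm : m ∣ n * ℓ), IsAdmissible (absoluteGaloisGroup K) (D m hm).pointsSubgroup ((p ^ k : ℕ) : ℤ) := by
    intro m hm
    have hm0 : m ≠ 0 := ne_zero_of_dvd_ne_zero hnℓ0 hm
    have hpm : ¬ p ∣ m := fun h ↦
      (hKol p (Nat.primeFactors_mono hm hnℓ0 (Nat.mem_primeFactors.mpr ⟨hp, h, hm0⟩))).1.2.2.2.1 rfl
    exact isAdmissible_pointsSubgroup_familyData hK (D m hm) (htor m hm0 hpm)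
  have hkey := keyRelation_familyData_of_labels hK ι hN hp hp2 hk Dt hnℓ hKol D hcoh hB4d hB5d hA (n * ℓ) dvd_rfl ℓ hℓmem v hv
  -- re-index the lower datum from `nℓ/ℓ` to `n`
  have hidx : ∀ (x : ℕ) (hx : x ∣ n * ℓ), x = n → ∀ a : ℕ,
      ((((p : ℤ) ^ a) • (D x hx).kolyvaginClass hp k ∈
          (W.baseChange K).torsionLocalKer (v.adicCompletion K) ((p ^ k : ℕ) : ℤ)) ↔
        (((p : ℤ) ^ a) • (D n hndvd).kolyvaginClass hp k ∈
          (W.baseChange K).torsionLocalKer (v.adicCompletion K) ((p ^ k : ℕ) : ℤ))) := by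
    rintro x hx rfl a; exact Iff.rfl
  -- (ii) the class at level `nℓ` is transverse at `ℓ`
  have htrv : (D (n * ℓ) dvd_rfl).kolyvaginClass hp k ∈ transverseKer W K ι ((p ^ k : ℕ) : ℤ) ℓ :=
    kolyvaginClass_familyData_mem_transverseKer W hK hD hp2 ι k hnℓ hKolN hkM (D (n * ℓ) dvd_rfl) hℓmem
  -- (iii) the coherent pair has equal local orders
  have hcohord : addOrderOf (loc ((D (n * ℓ) dvd_rfl).kolyvaginClass hp k)) =
      addOrderOf (loc ((D n hndvd).kolyvaginClass hp k)) := by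
    refine addOrderOf_eq_of_forall_pow_smul_eq_zero_iff (p := p) (k := k) hp
      (by rw [← map_nsmul]; exact (congrArg loc (hkill _)).trans (map_zero loc))
      (by rw [← map_nsmul]; exact (congrArg loc (hkill _)).trans (map_zero loc)) fun a ↦ ?_
    rw [hloc, localization_pow_smul_eq_zero_iff_mem_torsionLocalKer (W := W) hp v ((D (n * ℓ) dvd_rfl).kolyvaginClass hp k) a,
      localization_pow_smul_eq_zero_iff_mem_torsionLocalKer (W := W) hp v ((D n hndvd).kolyvaginClass hp k) a,
      ← mem_selmerLocalKer_iff_mem_torsionLocalKer_of_mem_transverseKer (W := W) hK hD ι k hℓZ v hv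
        (((p : ℤ) ^ a) • (D (n * ℓ) dvd_rfl).kolyvaginClass hp k)
        ((transverseKer W K ι ((p ^ k : ℕ) : ℤ) ℓ).zsmul_mem htrv ((p : ℤ) ^ a)),
      hkey a, hidx (n * ℓ / ℓ) _ hdiv a]
  -- (iv) choice-freeness: transport to `d'` and `d`
  have hB4top : ∀ (m : ℕ), m ∣ n * ℓ → ∀ x ∈ m.primeFactors, ∀ σ : ringClassField K ι m ≃ₐ[ℚ] ringClassField K ι m,
      Subgroup.zpowers σ = ringClassGalOver ι m (m / x) →
      ∃ y' : (W.baseChange (ringClassField K ι m)).toAffine.Point,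
        ∑ i ∈ Finset.range (x + 1), pointGalHom W (ringClassField K ι m) (σ ^ i) (ys m) = W.frobeniusTrace x • y' := by
    intro m hm x hx σ hσ
    have hm0 : m ≠ 0 := ne_zero_of_dvd_ne_zero hnℓ0 hm
    letI : Algebra K ℂ := ι.toAlgebra
    exact ⟨_, hL.2.2.2.2.1 m (hnℓ.squarefree_of_dvd hm) (fun q hq ↦ hguard q (Nat.primeFactors_mono hm hnℓ0 hq)) x hx
      (ringClassField_mono hK ι (Nat.div_dvd_of_dvd (Nat.dvd_of_mem_primeFactors hx)) hm0) σ hσ⟩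
  have hKolk : ∀ (m : ℕ), m ∣ n * ℓ → ∀ q ∈ m.primeFactors, IsKolyvaginPrime N W K p q ∧ FrobEqFrobInfty W K (p ^ k) q :=
    fun m hm q hq ↦ hKol q (Nat.primeFactors_mono hm hnℓ0 hq)
  have htop : addOrderOf (loc (d'.kolyvaginClass hp k)) = addOrderOf (loc ((D (n * ℓ) dvd_rfl).kolyvaginClass hp k)) :=
    addOrderOf_map_kolyvaginClass_eq (W := W) hK ι Dt hp hk hnℓ (hKolk _ dvd_rfl) (D (n * ℓ) dvd_rfl) d'
      (by rw [hd'y, hDy]) (by rw [hDy]; exact hB4top _ dvd_rfl) loc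
  have hbot : addOrderOf (loc (d.kolyvaginClass hp k)) = addOrderOf (loc ((D n hndvd).kolyvaginClass hp k)) :=
    addOrderOf_map_kolyvaginClass_eq (W := W) hK ι Dt hp hk hn (hKolk _ hndvd) (D n hndvd) d
      (by rw [hdy, hDy]) (by rw [hDy]; exact hB4top _ hndvd) loc
  rw [htop, hbot, hcohord]

set_option maxHeartbeats 800000 in
/-- **McCallum 4.4 in ORDER form for ARBITRARY pairs — admissibility in the composition's ∀-datum shape `hA`** (instead of
`htor`; tam3-p1's `Koly.levelSupplyAt_three_of_labels_of_familyProducers` binder `h47` VERBATIM up to the frame prefix), on a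
Shimura frame carrying the labels `LabelsAt W N K ι yK ys ε`: for data `d` at level `n`
and `d'` at level `n' = nℓ` with `d.y = ys n`, `d'.y = ys n'`, `nℓ` square-free with Gross–Kolyvagin prime factors satisfying (3.2)
modulo `p^k`, and a place `λ ∋ ℓ`: `addOrderOf (loc_λ c_k(d')) = addOrderOf (loc_λ c_k(d))`. See the module docstring for the
four-step proof (coherent family + key relation p601020; transverse p603631 + disjointness; `p`-power orders; choice-freeness p604141).
[cite: McCallumLMS1991, §4 Prop. 4.4, Cor. 4.5] [cite: Jetchev2008, Prop. 4.10 (ii)] [cite: GrossLMS1991, Prop. 3.7 (2), §4 (4.4)] -/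
theorem addOrderOf_localization_kolyvaginClass_familyData_eq_of_labels_of_admissible {N : ℕ} [NeZero N] [W.IsElliptic] [W.IsGloballyMinimal]
    (hK : IsImaginaryQuadratic K) (hD : NumberField.discr K < -4) (ι : K →+* ℂ) (hN : W.conductorNorm ℤ = N)
    {p : ℕ} [Fact p.Prime] (hp2 : p ≠ 2) (Dt : ModularParametrizationData W N) [∀ j : ℕ, NumberField (ringClassField K ι j)]
    (ys : (m : ℕ) → (W.baseChange (ringClassField K ι m)).toAffine.Point)
    {yK : (W.baseChange K).toAffine.Point} {ε : ℤ} (hL : LabelsAt W N K ι yK ys ε)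
    (hA : ∀ (m : ℕ) (dm : KolyvaginFamilyData W K ι m), dm.y = ys m → Squarefree m →
      (∀ q ∈ m.primeFactors, IsKolyvaginPrime N W K p q) →
      ∀ j : ℕ, IsAdmissible (absoluteGaloisGroup K) dm.pointsSubgroup ((p ^ j : ℕ) : ℤ))
    (k n n' : ℕ) (d : KolyvaginFamilyData W K ι n) (d' : KolyvaginFamilyData W K ι n') (ℓ : ℕ)
    (hk : 1 ≤ k) (hdy : d.y = ys n) (hd'y : d'.y = ys n') (hn : Squarefree n)
    (hKol : ∀ q ∈ n'.primeFactors, IsKolyvaginPrime N W K p q ∧ FrobEqFrobInfty W K (p ^ k) q)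
    (hℓ : ℓ.Prime) (hℓn : ¬ ℓ ∣ n) (hn' : n' = n * ℓ)
    (v : HeightOneSpectrum (𝓞 K)) (hv : (ℓ : 𝓞 K) ∈ v.asIdeal) :
    addOrderOf (galoisCohomology.localization ((W.baseChange K).torsionGaloisModule ((p ^ k : ℕ) : ℤ)) (Sum.inr v) 1
        (d'.kolyvaginClass (Fact.out : p.Prime) k)) =
      addOrderOf (galoisCohomology.localization ((W.baseChange K).torsionGaloisModule ((p ^ k : ℕ) : ℤ)) (Sum.inr v) 1
        (d.kolyvaginClass (Fact.out : p.Prime) k)) := by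
  subst hn'
  have hp : p.Prime := Fact.out
  set loc := galoisCohomology.localization ((W.baseChange K).torsionGaloisModule ((p ^ k : ℕ) : ℤ)) (Sum.inr v) 1
    with hloc
  have hkill : ∀ z : galH1Torsion (W.baseChange K) ((p ^ k : ℕ) : ℤ), p ^ k • z = 0 := fun z ↦ by
    rw [← natCast_zsmul]; exact zsmul_galH1Torsion_eq_zero (W.baseChange K) _ z
  -- the level `nℓ`
  have hcop : n.Coprime ℓ := (Nat.Coprime.symm ((Nat.Prime.coprime_iff_not_dvd hℓ).mpr hℓn))
  have hnℓ : Squarefree (n * ℓ) := (Nat.squarefree_mul hcop).mpr ⟨hn, hℓ.prime.squarefree⟩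
  have hnℓ0 : n * ℓ ≠ 0 := hnℓ.ne_zero
  have hℓmem : ℓ ∈ (n * ℓ).primeFactors := Nat.mem_primeFactors.mpr ⟨hℓ, dvd_mul_left ℓ n, hnℓ0⟩
  have hndvd : n ∣ n * ℓ := dvd_mul_right n ℓ
  have hdiv : n * ℓ / ℓ = n := Nat.mul_div_cancel n hℓ.pos
  have hKolN : ∀ q ∈ (n * ℓ).primeFactors, IsKolyvaginPrime (W.conductorNorm ℤ) W K p q := fun q hq ↦ hN ▸ (hKol q hq).1
  have hguard : ∀ q ∈ (n * ℓ).primeFactors, ¬ q ∣ N ∧ (Ideal.span {(q : 𝓞 K)}).IsPrime :=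
    fun q hq ↦ ⟨(hKol q hq).1.2.1, (hKol q hq).1.2.2.2.2.1⟩
  have hℓZ : Zhang2014.IsKolyvaginPrime (W.conductorNorm ℤ) W K p ℓ :=
    (Summit.BirchSwinnertonDyer.Rank1Residual.X11b.Three.Koly.zhang_isKolyvaginPrime_of_frobEqFrobInfty (W := W) (K := K)
      hp hk (hKolN ℓ hℓmem) (hKol ℓ hℓmem).2).1
  have hkM : (k : ℕ∞) ≤ frobLevelIndex W K p (n * ℓ) :=
    (natCast_le_frobLevelIndex_iff hKolN k).mpr fun q hq ↦ (hKol q hq).2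
  -- (i) a coherent family on the divisors of `nℓ` with `D.y = ys`, its labels and admissibility
  obtain ⟨D, hDy, -, hcoh⟩ := exists_coherent_familyData_y_eq (W := W) hK ι hnℓ (fun q hq ↦ (hguard q hq).2) ys
  obtain ⟨hB4d, hB5d, -⟩ := familyLabels_of_labelsAt (W := W) hnℓ hguard ys hL D hDy
  have hA' : ∀ (m : ℕ) (hm : m ∣ n * ℓ), IsAdmissible (absoluteGaloisGroup K) (D m hm).pointsSubgroup ((p ^ k : ℕ) : ℤ) :=
    fun m hm ↦ hA m (D m hm) (hDy m hm) (hnℓ.squarefree_of_dvd hm)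
      (fun q hq ↦ (hKol q (Nat.primeFactors_mono hm hnℓ0 hq)).1) k
  have hkey := keyRelation_familyData_of_labels hK ι hN hp hp2 hk Dt hnℓ hKol D hcoh hB4d hB5d hA' (n * ℓ) dvd_rfl ℓ hℓmem v hv
  -- re-index the lower datum from `nℓ/ℓ` to `n`
  have hidx : ∀ (x : ℕ) (hx : x ∣ n * ℓ), x = n → ∀ a : ℕ,
      ((((p : ℤ) ^ a) • (D x hx).kolyvaginClass hp k ∈
          (W.baseChange K).torsionLocalKer (v.adicCompletion K) ((p ^ k : ℕ) : ℤ)) ↔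
        (((p : ℤ) ^ a) • (D n hndvd).kolyvaginClass hp k ∈
          (W.baseChange K).torsionLocalKer (v.adicCompletion K) ((p ^ k : ℕ) : ℤ))) := by
    rintro x hx rfl a; exact Iff.rfl
  -- (ii) the class at level `nℓ` is transverse at `ℓ`
  have htrv : (D (n * ℓ) dvd_rfl).kolyvaginClass hp k ∈ transverseKer W K ι ((p ^ k : ℕ) : ℤ) ℓ :=
    kolyvaginClass_familyData_mem_transverseKer W hK hD hp2 ι k hnℓ hKolN hkM (D (n * ℓ) dvd_rfl) hℓmem
  -- (iii) the coherent pair has equal local orders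
  have hcohord : addOrderOf (loc ((D (n * ℓ) dvd_rfl).kolyvaginClass hp k)) =
      addOrderOf (loc ((D n hndvd).kolyvaginClass hp k)) := by
    refine addOrderOf_eq_of_forall_pow_smul_eq_zero_iff (p := p) (k := k) hp
      (by rw [← map_nsmul]; exact (congrArg loc (hkill _)).trans (map_zero loc))
      (by rw [← map_nsmul]; exact (congrArg loc (hkill _)).trans (map_zero loc)) fun a ↦ ?_
    rw [hloc, localization_pow_smul_eq_zero_iff_mem_torsionLocalKer (W := W) hp v ((D (n * ℓ) dvd_rfl).kolyvaginClass hp k) a,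
      localization_pow_smul_eq_zero_iff_mem_torsionLocalKer (W := W) hp v ((D n hndvd).kolyvaginClass hp k) a,
      ← mem_selmerLocalKer_iff_mem_torsionLocalKer_of_mem_transverseKer (W := W) hK hD ι k hℓZ v hv
        (((p : ℤ) ^ a) • (D (n * ℓ) dvd_rfl).kolyvaginClass hp k)
        ((transverseKer W K ι ((p ^ k : ℕ) : ℤ) ℓ).zsmul_mem htrv ((p : ℤ) ^ a)),
      hkey a, hidx (n * ℓ / ℓ) _ hdiv a]
  -- (iv) choice-freeness: transport to `d'` and `d`
  have hB4top : ∀ (m : ℕ), m ∣ n * ℓ → ∀ x ∈ m.primeFactors, ∀ σ : ringClassField K ι m ≃ₐ[ℚ] ringClassField K ι m,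
      Subgroup.zpowers σ = ringClassGalOver ι m (m / x) →
      ∃ y' : (W.baseChange (ringClassField K ι m)).toAffine.Point,
        ∑ i ∈ Finset.range (x + 1), pointGalHom W (ringClassField K ι m) (σ ^ i) (ys m) = W.frobeniusTrace x • y' := by
    intro m hm x hx σ hσ
    have hm0 : m ≠ 0 := ne_zero_of_dvd_ne_zero hnℓ0 hm
    letI : Algebra K ℂ := ι.toAlgebra
    exact ⟨_, hL.2.2.2.2.1 m (hnℓ.squarefree_of_dvd hm) (fun q hq ↦ hguard q (Nat.primeFactors_mono hm hnℓ0 hq)) x hx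
      (ringClassField_mono hK ι (Nat.div_dvd_of_dvd (Nat.dvd_of_mem_primeFactors hx)) hm0) σ hσ⟩
  have hKolk : ∀ (m : ℕ), m ∣ n * ℓ → ∀ q ∈ m.primeFactors, IsKolyvaginPrime N W K p q ∧ FrobEqFrobInfty W K (p ^ k) q :=
    fun m hm q hq ↦ hKol q (Nat.primeFactors_mono hm hnℓ0 hq)
  have htop : addOrderOf (loc (d'.kolyvaginClass hp k)) = addOrderOf (loc ((D (n * ℓ) dvd_rfl).kolyvaginClass hp k)) :=
    addOrderOf_map_kolyvaginClass_eq (W := W) hK ι Dt hp hk hnℓ (hKolk _ dvd_rfl) (D (n * ℓ) dvd_rfl) d'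
      (by rw [hd'y, hDy]) (by rw [hDy]; exact hB4top _ dvd_rfl) loc
  have hbot : addOrderOf (loc (d.kolyvaginClass hp k)) = addOrderOf (loc ((D n hndvd).kolyvaginClass hp k)) :=
    addOrderOf_map_kolyvaginClass_eq (W := W) hK ι Dt hp hk hn (hKolk _ hndvd) (D n hndvd) d
      (by rw [hdy, hDy]) (by rw [hDy]; exact hB4top _ hndvd) loc
  rw [htop, hbot, hcohord]

end Summit.BirchSwinnertonDyer.BirchSwinnertonDyer.Theorems.ShimuraWalk

end
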